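import Summits.QuantumFields.BalabanUV.T4Continuum.Support.B13KPStepTermModel

/-!
# NE5 ∕ U3, route P2 — THE R-IDENT WINDOW BINDERS FROM L03's LETTERS: `LevelSummable` ∕ `ClusAbsConv` of the model of record at an
# input point from a (2.38)-shaped majorant of the activities there, and route P2's END on the HOLDER's functionals of record with the
# four window binders DISCHARGED (term-format slots: reference data at the two runs' own input points)

Cell `pub-balaban`, unit `b2b-balaban-t4-ne5-p2` (T⁴ fan-out NE5 ∕ node U3, PROVER seat P2 «polymer-activity Lipschitz ∕
Kotecký–Preiss route», lineage gen 19; part 2 of `B13KPStepTermModel`).  Summits-side new work under the LEAN PLACEMENT RULE (cell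
bookkeeping over the swarm's objects of record; NOT a Literature module; nothing of the manuscripts under audit is asserted).  HONEST
FRAMING: rung (B)+1 of the FINITE-VOLUME T⁴ continuum programme — NOT infinite volume, NOT a mass gap, NOT the Clay problem, and **NOT A
PROOF OF NE5** (spine 0∕9).  HONEST DEPENDENCY (cell line, verbatim): continuum YM on T⁴ ⇐ BetaPertH ∧ nine spine estimates (0/9
proved); BetaPertH ⇐ (D1) ∧ (D4) ∧ CAP+tail; G-an2-4 gates asym, D1 and NE2/3/4.

WHY ∕ WHAT.  Part 1's END on the HOLDER's functionals of record (`ne5_above_max_record_termModel`, through R-IDENT) displays FOUR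
window binders (`LevelSummable` ∕ `ClusAbsConv` of the activities of record at both runs' input points of the KP recursion) and the
two one-run LEVELS.  Here, for term-format slots, all six become THEOREMS of data already displayed:
* §1 `sum_anchored_le_of_majorant` — on the domain geometry of record a weight `n ≤ A·e^{−R_m·d}` (`A ≥ 0`) on 𝐃_k with
  `64·log 162 + 64 ≤ R_m` has anchored exponential norm `≤ A·e^{64}·K₀(64,8)` at every cube ((1.26) `ineq126_level` + (2.30)
  `volBound_level`, THEOREMS of the torus geometry); §1b `decayBoundA_of_baseMajorant` — the run-A twin of K2's
  `InputModel.decayBound_of_baseMajorant` (generic);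
* §2 for ANY slots `S`: `levelSummable_of_actNorm` ∕ `clusAbsConv_of_actNorm` (gen 18's plugs `B13OutKPForm.summable_levelNorm_of_actNorm`
  ∕ `summable_UKabs_of_actNorm` with `loc_b13`, `reach_b13`, ν = 9) and **`window_of_majorant`**: `Σ_ℓ ‖S.act Z ℓ q‖ ≤ A_m·e^{−R_m·d(Z)}` on
  𝐃_{scale X} ∧ `64·log 162 + 64 ≤ R_m` ∧ `36·A_m·e^{64}·K₀(64,8) < 1` ⟹ `LevelSummable S X q ∧ ClusAbsConv S X q`;
* §3 for TERM-FORMAT slots: `norm_act_le_size` (K6 `norm_term_le`), `actNorm_le_majorant_of_refAt` (`RefAt` for every term at `q` ∧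
  `WellFormed` ∧ `hsum` ∧ L03's bound on `m` ⟹ §2's hypothesis at `q`), **`ne5_above_max_record_termModel_of_refAt`** (part 1's END with
  the four window binders DISCHARGED — displayed instead: `RefAt` of every term of record at run A's OWN input point `inputA_KP`, next to
  run B's, and the two window numerics), `decayBound_outB_KP_of_refAt` ∕ `decayBound_outA_KP_of_refAt` (L09 for BOTH runs' KP outputs
  of record at the level `64τe^{−5σ}` — (2.41) KIND — from L03 + `WellFormed` + `hsum` + L06 at the run's own input point) and
  **`ne5_above_max_record_termModel_levels`**: the END on the holder's functionals with window binders AND levels DISCHARGED.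
HONEST: NOT a proof of NE5; cores and constants are NAMED PARAMETERS; W1∕W3∕W4 and the numerics stay displayed.
0 sorry; axioms ⊆ {propext, Classical.choice, Quot.sound}.
-/

noncomputable section

open MeasureTheory
open scoped BigOperators

namespace Summit.QuantumFields.BalabanUV.T4Continuum.B13KPStepTermWindow

open Literature.MathematicalPhysics.QuantumFieldTheory.Balaban1983to89
open Literature.MathematicalPhysics.QuantumFieldTheory.Balaban1983to89.T4OutputRate (Carriers Functional DecayBound NE5)
open Literature.MathematicalPhysics.QuantumFieldTheory.Balaban1983to89.T4InputCauchyRateData (StepModel tableA tableB)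
open Literature.MathematicalPhysics.QuantumFieldTheory.Balaban1983to89.T4ActivityLipschitz (ClusterRep)
open Literature.MathematicalPhysics.QuantumFieldTheory.Balaban1983to89.T4ActivityRecursion (InputModel KPInflated
  norm_clusterSum_clus_le_of_kp)
open Summit.QuantumFields.BalabanUV.T4Continuum.ActivityTermModel (TermDatum TermConsts TermFamily)
open Summit.QuantumFields.BalabanUV.T4Continuum.B13Carriers (TwoRuns)
open Summit.QuantumFields.BalabanUV.T4Continuum.ClusterRepOfDomains (DomainGeometry)
open Summit.QuantumFields.BalabanUV.T4Continuum.B13DomainGeometryTR (SCube domainGeometry clusterRep footprint reach loc_b13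
  reach_b13 ineq126_level volBound_level decayExtract_b13 pinBudget_b13 kpInflated_b13)
open Summit.QuantumFields.BalabanUV.T4Continuum.B13InnerData (b13InnerData Bnd)
open Summit.QuantumFields.BalabanUV.T4Continuum.B13OpDatum (OpDatum Species)
open Summit.QuantumFields.BalabanUV.T4Continuum.B13HistMeasurable (MeasPotFrame B13HistM)
open Summit.QuantumFields.BalabanUV.T4Continuum.B13StepOfRecord (Slots step outA outB assembly)
open Summit.QuantumFields.BalabanUV.T4Continuum.B13StepTermLabels (InnerLabel innerLabels)
open Summit.QuantumFields.BalabanUV.T4Continuum.B13OutKPForm (summable_levelNorm_of_actNorm summable_UKabs_of_actNorm)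
open Summit.QuantumFields.BalabanUV.T4Continuum.B13OutKPFormRecord (LevelSummable ClusAbsConv)
open Summit.QuantumFields.BalabanUV.T4Continuum.B13KPStepOfRecord (outA_KP outB_KP rhoA rhoB inputModel inputA_KP inputB_KP
  represents_kp)
open Summit.QuantumFields.BalabanUV.T4Continuum.B13TermData (TermCore termData)
open Summit.QuantumFields.BalabanUV.T4Continuum.B13StepOfRecordTermData (TermSlots)
open Summit.QuantumFields.BalabanUV.T4Continuum.B13KPStepTermModel (termFamily realizes_termFamily inBase_termFamily
  ne5_above_max_record_termModel)
open Summit.QuantumFields.BalabanUV.T4Continuum.UrsellTermBudget (actSum)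
open Summit.QuantumFields.BalabanUV.T4Continuum.UrsellTreeSum (ind)

variable {𝔾 : Type} [GaugeGroup 𝔾] {R : TwoRuns 𝔾}

/-! ## §1 The anchored exponential norm of a (2.38)-shaped majorant on Bałaban's domains -/

/-- [folklore] **ANCHORED NORM FROM A (2.38)-SHAPED MAJORANT.**  On the domain geometry of record, a weight `n(Z) ≤ A·e^{−R_m·d(Z)}`
(`A ≥ 0`) on the step-`k` catalogue with the rate room `64·log 162 + 64 ≤ R_m` satisfies, at every cube `c`,
`Σ_{Z ∈ 𝐃_k} 𝟙(c ∈ cubes Z)·n(Z)·e^{#cubes(Z)} ≤ A·e^{64}·K₀(64,8)` — by (2.30) `#cubes(Z) ≤ 64(1 + d(Z))` (`volBound_level`) and (1.26)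
`Σ_{Z ∋ c} e^{−64·log 162·d(Z)} ≤ K₀(64,8)` (`ineq126_level`), both THEOREMS of the torus geometry. -/
theorem sum_anchored_le_of_majorant {k : ℕ} {n : R.carriers.Dom → ℝ} {A Rm : ℝ} (hA : 0 ≤ A)
    (hn : ∀ Z ∈ (domainGeometry R).level k, n Z ≤ A * Real.exp (-(Rm * R.carriers.d Z)))
    (hrate : 64 * Real.log 162 + 64 ≤ Rm) (c : SCube R) :
    ∑ Z ∈ (domainGeometry R).level k, ind (c ∈ footprint Z) * n Z * Real.exp ((footprint Z).card : ℝ) ≤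
      A * Real.exp 64 * B12TreeDecay.K₀ (4 * 2 ^ 4) (2 * 4) := by
  have h126 : ∑ Z ∈ ((domainGeometry R).level k).filter (fun Z => c ∈ footprint Z),
      Real.exp (-(64 * Real.log 162 * R.carriers.d Z)) ≤ B12TreeDecay.K₀ (4 * 2 ^ 4) (2 * 4) := ineq126_level (R := R) k c
  have hvol : ∀ Z ∈ (domainGeometry R).level k, ((footprint Z).card : ℝ) ≤ 64 * (1 + R.carriers.d Z) :=
    fun Z hZ => volBound_level (R := R) k Z hZ
  have hAe : 0 ≤ A * Real.exp 64 := mul_nonneg hA (Real.exp_nonneg _)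
  -- the pointwise bound on the catalogue
  have hpt : ∀ Z ∈ (domainGeometry R).level k,
      n Z * Real.exp ((footprint Z).card : ℝ) ≤ A * Real.exp 64 * Real.exp (-(64 * Real.log 162 * R.carriers.d Z)) := by
    intro Z hZ
    have hd := R.carriers.d_nonneg Z
    calc n Z * Real.exp ((footprint Z).card : ℝ)
        ≤ (A * Real.exp (-(Rm * R.carriers.d Z))) * Real.exp (64 * (1 + R.carriers.d Z)) :=
          mul_le_mul (hn Z hZ) (Real.exp_le_exp.2 (hvol Z hZ)) (Real.exp_nonneg _)
            (mul_nonneg hA (Real.exp_nonneg _))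
      _ = A * Real.exp 64 * Real.exp (-((Rm - 64) * R.carriers.d Z)) := by
          rw [mul_assoc, ← Real.exp_add, mul_assoc, ← Real.exp_add]
          congr 2
          ring
      _ ≤ A * Real.exp 64 * Real.exp (-(64 * Real.log 162 * R.carriers.d Z)) := by
          refine mul_le_mul_of_nonneg_left (Real.exp_le_exp.2 (neg_le_neg ?_)) hAe
          exact mul_le_mul_of_nonneg_right (by linarith) hd
  -- the indicator sum is the sum over the anchored sub-catalogue
  have heq : ∑ Z ∈ (domainGeometry R).level k, ind (c ∈ footprint Z) * n Z * Real.exp ((footprint Z).card : ℝ) =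
      ∑ Z ∈ ((domainGeometry R).level k).filter (fun Z => c ∈ footprint Z), n Z * Real.exp ((footprint Z).card : ℝ) := by
    rw [Finset.sum_filter]
    refine Finset.sum_congr rfl fun Z _ => ?_
    unfold ind
    split_ifs <;> simp
  rw [heq]
  calc ∑ Z ∈ ((domainGeometry R).level k).filter (fun Z => c ∈ footprint Z), n Z * Real.exp ((footprint Z).card : ℝ)
      ≤ ∑ Z ∈ ((domainGeometry R).level k).filter (fun Z => c ∈ footprint Z),
          A * Real.exp 64 * Real.exp (-(64 * Real.log 162 * R.carriers.d Z)) :=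
        Finset.sum_le_sum fun Z hZ => hpt Z (Finset.mem_filter.1 hZ).1
    _ = A * Real.exp 64 * ∑ Z ∈ ((domainGeometry R).level k).filter (fun Z => c ∈ footprint Z),
          Real.exp (-(64 * Real.log 162 * R.carriers.d Z)) := by rw [Finset.mul_sum]
    _ ≤ A * Real.exp 64 * B12TreeDecay.K₀ (4 * 2 ^ 4) (2 * 4) := mul_le_mul_of_nonneg_left h126 hAe

/-! ## §1b Run A's one-run level from a majorant at run A's own input point (the run-A twin of
## `T4ActivityRecursion.InputModel.decayBound_of_baseMajorant`) -/

section RunA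

variable {C : Carriers} {Rc : ClusterRep C} {Op Hist : Type*} [NormedAddCommGroup Op] [NormedSpace ℂ Op] [NormedAddCommGroup Hist]
  [NormedSpace ℂ Hist] (M : InputModel Rc Op Hist)

/-- [folklore] **RUN A's LEVEL FROM THE MAJORANT** (one run; (2.39)–(2.41) of [Balaban1988RG2Cluster] in KP form, read for run A): if run
A's own input point is admissible, the activities are under `m` there, `m` (inflated) obeys the Kotecký–Preiss condition, the decay is
extracted and the pin budget holds with `A ≥ 0`, and the represented functional vanishes off the image of the transport (as
`StepRecursion.recA` does), then `DecayBound EA W A κ`. -/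
theorem decayBoundA_of_baseMajorant {EA : Functional C C.BgA} {EB : Functional C C.BgB} {W : Set (ℕ → ℝ)}
    {m : (ℕ → ℝ) → C.BgB → Rc.P → ℝ} {a d : Rc.P → ℝ} {δX : C.Dom → ℝ} {A κ s : ℝ}
    (hrep : Rc.Represents EA EB) (hreal : M.Realizes EA EB W)
    (hbaseA : ∀ g ∈ W, ∀ (U : C.BgB) (X : C.Dom), M.pointA EA g U X ∈ M.Base g U X) (hmaj : M.BaseMajorant W m)
    (hKP : KPInflated Rc W m s a d) (hs : 0 ≤ s) (hdec : Rc.DecayExtract δX d) (hpin : Rc.PinBudget a δX A κ) (hA : 0 ≤ A)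
    (hoff : ∀ g ∈ W, ∀ V : C.BgA, (¬ ∃ U : C.BgB, C.transport U = V) → ∀ X : C.Dom, EA g V X = 0) :
    DecayBound EA W A κ := by
  obtain ⟨ha, hd, hKP'⟩ := hKP
  intro g hg V X
  by_cases hV : ∃ U : C.BgB, C.transport U = V
  · obtain ⟨U, rfl⟩ := hV
    have hm : ∀ γ ∈ Rc.vol X, ‖Rc.ρA g U γ‖ ≤ m g U γ := fun γ hγ => by
      rw [← (hreal g hg U X γ hγ).2]
      exact hmaj g hg U X _ (hbaseA g hg U X) γ hγ
    have hkp : ∀ γ ∈ Rc.vol X, ∑ γ' ∈ Rc.vol X with Rc.inc γ' γ, m g U γ' * Real.exp (a γ' + d γ') ≤ a γ := by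
      intro γ hγ
      refine le_trans (Finset.sum_le_sum fun γ' hγ' => ?_) (hKP' g hg U X γ hγ)
      have hm0 : 0 ≤ m g U γ' := (norm_nonneg _).trans (hm γ' (Finset.mem_filter.1 hγ').1)
      exact mul_le_mul_of_nonneg_right (by nlinarith) (Real.exp_nonneg _)
    rw [hrep.1 g U X]
    calc |(Rc.outA g U X).re| ≤ ‖Rc.outA g U X‖ := Complex.abs_re_le_norm _
      _ ≤ a (Rc.pin X) * Real.exp (-(δX X)) := norm_clusterSum_clus_le_of_kp Rc ha hd hm hkp (hdec X)
      _ ≤ A * Real.exp (-(κ * C.d X)) := hpin X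
  · rw [hoff g hg V hV X, abs_zero]
    exact mul_nonneg hA (Real.exp_nonneg _)

end RunA

/-! ## §2 The two window binders of the model of record at an input point, for any slots -/

section AnySlots

variable {E IOp Hist : Type*} [NormedAddCommGroup Hist] [NormedSpace ℂ Hist] (S : Slots R E IOp Hist)

/-- [folklore] **BINDER (i) ON THE CARRIERS OF RECORD** (`summable_levelNorm_of_actNorm`, `loc_b13`∕`reach_b13`, ν = 9; `36Φ < 1`). -/
theorem levelSummable_of_actNorm {X : R.carriers.Dom} {q : OpDatum E × Hist}
    {A : R.carriers.Dom → InnerLabel R.carriers.Dom (Bnd R) → ℝ} {Φ : ℝ} (hA : ∀ Z ℓ, 0 ≤ A Z ℓ) (hΦ0 : 0 ≤ Φ)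
    (hsmall : 36 * Φ < 1)
    (hΦ : ∀ c : SCube R, ∑ Z ∈ (domainGeometry R).level (R.carriers.scale X),
      ind (c ∈ footprint Z) * actSum (b13InnerData R) A (R.carriers.scale X) Z * Real.exp ((footprint Z).card : ℝ) ≤ Φ)
    (hact : ∀ Z ∈ (domainGeometry R).level (R.carriers.scale X), ∀ ℓ ∈ innerLabels (b13InnerData R) (R.carriers.scale X) Z,
      ‖S.act Z ℓ q.1 q.2‖ ≤ A Z ℓ) :
    LevelSummable S X q :=
  summable_levelNorm_of_actNorm (domainGeometry R) (b13InnerData R) S.act A reach hA loc_b13 (by norm_num) reach_b13 hΦ0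
    (by linarith) hΦ hact rfl

/-- [folklore] **BINDER (ii) ON THE CARRIERS OF RECORD** (`B13OutKPForm.summable_UKabs_of_actNorm`): same data, `ClusAbsConv S X q`. -/
theorem clusAbsConv_of_actNorm {X : R.carriers.Dom} {q : OpDatum E × Hist}
    {A : R.carriers.Dom → InnerLabel R.carriers.Dom (Bnd R) → ℝ} {Φ : ℝ} (hA : ∀ Z ℓ, 0 ≤ A Z ℓ) (hΦ0 : 0 ≤ Φ)
    (hsmall : 36 * Φ < 1)
    (hΦ : ∀ c : SCube R, ∑ Z ∈ (domainGeometry R).level (R.carriers.scale X),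
      ind (c ∈ footprint Z) * actSum (b13InnerData R) A (R.carriers.scale X) Z * Real.exp ((footprint Z).card : ℝ) ≤ Φ)
    (hact : ∀ Z ∈ (domainGeometry R).level (R.carriers.scale X), ∀ ℓ ∈ innerLabels (b13InnerData R) (R.carriers.scale X) Z,
      ‖S.act Z ℓ q.1 q.2‖ ≤ A Z ℓ) :
    ClusAbsConv S X q := fun _ hK =>
  summable_UKabs_of_actNorm (domainGeometry R) (b13InnerData R) S.act A reach hA loc_b13 (by norm_num) reach_b13 hΦ0
    (by linarith) hΦ hact rfl hK

/-- [folklore] **BOTH WINDOW BINDERS FROM A (2.38)-SHAPED MAJORANT OF THE ACTIVITIES AT THE INPUT POINT** `q` of `X`: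
`Σ_ℓ ‖S.act Z ℓ q‖ ≤ A_m·e^{−R_m·d(Z)}` on 𝐃_{scale X}, `64·log 162 + 64 ≤ R_m`, `36·A_m·e^{64}·K₀(64,8) < 1` ⟹ both (§1, norms as majorant). -/
theorem window_of_majorant {X : R.carriers.Dom} {q : OpDatum E × Hist} {A_m R_m : ℝ} (hA_m : 0 ≤ A_m)
    (hn : ∀ Z ∈ (domainGeometry R).level (R.carriers.scale X),
      ∑ ℓ ∈ innerLabels (b13InnerData R) (R.carriers.scale X) Z, ‖S.act Z ℓ q.1 q.2‖ ≤ A_m * Real.exp (-(R_m * R.carriers.d Z)))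
    (hrate' : 64 * Real.log 162 + 64 ≤ R_m) (hsmall' : 36 * (A_m * Real.exp 64 * B12TreeDecay.K₀ (4 * 2 ^ 4) (2 * 4)) < 1) :
    LevelSummable S X q ∧ ClusAbsConv S X q := by
  have hA : ∀ (Z : R.carriers.Dom) (ℓ : InnerLabel R.carriers.Dom (Bnd R)), 0 ≤ ‖S.act Z ℓ q.1 q.2‖ := fun _ _ => norm_nonneg _
  have hact : ∀ Z ∈ (domainGeometry R).level (R.carriers.scale X), ∀ ℓ ∈ innerLabels (b13InnerData R) (R.carriers.scale X) Z,
      ‖S.act Z ℓ q.1 q.2‖ ≤ (fun Z ℓ => ‖S.act Z ℓ q.1 q.2‖) Z ℓ := fun _ _ _ _ => le_rfl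
  have hΦ0 : 0 ≤ A_m * Real.exp 64 * B12TreeDecay.K₀ (4 * 2 ^ 4) (2 * 4) :=
    mul_nonneg (mul_nonneg hA_m (Real.exp_nonneg _)) (B12TreeDecay.K₀_pos _ _).le
  have hΦ := sum_anchored_le_of_majorant (R := R) (k := R.carriers.scale X)
    (n := fun Z => actSum (b13InnerData R) (fun Z ℓ => ‖S.act Z ℓ q.1 q.2‖) (R.carriers.scale X) Z) hA_m
    (fun Z hZ => hn Z hZ) hrate'
  exact ⟨levelSummable_of_actNorm S hA hΦ0 hsmall' hΦ hact, clusAbsConv_of_actNorm S hA hΦ0 hsmall' hΦ hact⟩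

/-- [folklore] Off the image of the transport the KP recursion's run-A output is `0` (`StepRecursion.recA`). -/
theorem outA_KP_of_not_transport (E₀ cB : ℝ) {g : ℕ → ℝ} {V : R.carriers.BgA} (hV : ¬ ∃ U : R.carriers.BgB, R.carriers.transport U = V)
    (X : R.carriers.Dom) : outA_KP S E₀ cB g V X = 0 := by
  unfold outA_KP StepRecursion.recA
  rw [dif_neg hV]

end AnySlots

/-! ## §3 Term-format slots: the activity majorant at a point carrying route P2's reference data, and the END on the holder's
## functionals of record with the four window binders discharged -/

section TermFormat

variable {P : MeasPotFrame R.carriers} {𝒴 : Type*} {dom : 𝒴 → R.carriers.Dom} {T κ ι S Ω Ω₀ 𝒞 IOp : Type*} [MeasurableSpace Ω]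
  [MeasurableSpace Ω₀] [Fintype ι] [Fintype κ] [DecidableEq ι] [DecidableEq κ] (𝔖 : TermSlots R P dom T κ ι S Ω Ω₀ 𝒞 IOp) (E₀ cB : ℝ)
  (𝔡 : R.carriers.Dom → InnerLabel R.carriers.Dom (Bnd R) → TermConsts)

/-- [folklore] **ONE TERM OF RECORD AT A POINT CARRYING REFERENCE DATA IS UNDER ITS SIZE** (K6 `TermDatum.norm_term_le`: `‖z⁻¹•∫F‖ ≤ M′∕ζ`
from the exponential-moment majorant and the normalisation floor; admissible constants). -/
theorem norm_act_le_size {Z : R.carriers.Dom} {ℓ : InnerLabel R.carriers.Dom (Bnd R)} {q : OpDatum (Species T κ ι Ω 𝒴) × B13HistM P}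
    {𝔠 : TermConsts} (hadm : 𝔠.Admissible) (href : (termData 𝔖.F 𝔖.G 𝔖.rHist 𝔖.core Z ℓ).RefAt 𝔠 q) :
    ‖𝔖.toSlots.act Z ℓ q.1 q.2‖ ≤ 𝔠.size :=
  (termData 𝔖.F 𝔖.G 𝔖.rHist 𝔖.core Z ℓ).norm_term_le 𝔠 hadm href

variable [DecidableEq 𝒞]

/-- [folklore] **THE (2.38)-SHAPED ACTIVITY MAJORANT AT A POINT CARRYING REFERENCE DATA FOR EVERY TERM**: well-formedness (admissible
constants), `hsum` and `m ≤ A_m·e^{−R_m·d}` give, at any input `q` of `X` with `RefAt` for every term of every step-`scale X` polymer,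
`Σ_ℓ ‖act Z ℓ q‖ ≤ A_m·e^{−R_m·d(Z)}` — the hypothesis of `window_of_majorant` (sizes ≤ `G`, the amplitudes being nonnegative). -/
theorem actNorm_le_majorant_of_refAt {W : Set (ℕ → ℝ)} {m : (ℕ → ℝ) → R.carriers.BgB → R.carriers.Dom → ℝ}
    {Λop Λhist ρ₀ A_m R_m : ℝ} (hΛop : 0 < Λop) (hΛhist : 0 < Λhist) (hwf : (termFamily 𝔖 E₀ cB 𝔡).WellFormed W)
    (hsum : ∀ g ∈ W, ∀ (U : R.carriers.BgB) (X : R.carriers.Dom), ∀ Z ∈ (domainGeometry R).level (R.carriers.scale X),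
      ∑ ℓ ∈ innerLabels (b13InnerData R) (R.carriers.scale X) Z, (termFamily 𝔖 E₀ cB 𝔡).G Λop Λhist ρ₀ g U X Z ℓ ≤ m g U Z)
    (hm : ∀ g ∈ W, ∀ (U : R.carriers.BgB) (k : ℕ), ∀ Z ∈ R.domAt k, m g U Z ≤ A_m * Real.exp (-(R_m * R.carriers.d Z)))
    {g : ℕ → ℝ} (hg : g ∈ W) (U : R.carriers.BgB) (X : R.carriers.Dom) {q : OpDatum (Species T κ ι Ω 𝒴) × B13HistM P}
    (hRef : ∀ Z ∈ (domainGeometry R).level (R.carriers.scale X), ∀ ℓ ∈ innerLabels (b13InnerData R) (R.carriers.scale X) Z,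
      (termData 𝔖.F 𝔖.G 𝔖.rHist 𝔖.core Z ℓ).RefAt (𝔡 Z ℓ) q) :
    ∀ Z ∈ (domainGeometry R).level (R.carriers.scale X),
      ∑ ℓ ∈ innerLabels (b13InnerData R) (R.carriers.scale X) Z, ‖𝔖.toSlots.act Z ℓ q.1 q.2‖ ≤
        A_m * Real.exp (-(R_m * R.carriers.d Z)) := by
  intro Z hZ
  refine le_trans (Finset.sum_le_sum fun ℓ hℓ => ?_) ((hsum g hg U X Z hZ).trans (hm g hg U (R.carriers.scale X) Z hZ))
  have hadm : (𝔡 Z ℓ).Admissible := hwf.hadm g hg U X Z hZ ℓ hℓ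
  obtain ⟨hAop, hAh, -⟩ := (termData 𝔖.F 𝔖.G 𝔖.rHist 𝔖.core Z ℓ).amp_nonneg (𝔡 Z ℓ) hadm ρ₀
  have h1 := norm_act_le_size 𝔖 hadm (hRef Z hZ ℓ hℓ)
  show ‖𝔖.toSlots.act Z ℓ q.1 q.2‖ ≤ (𝔡 Z ℓ).size
    + (termData 𝔖.F 𝔖.G 𝔖.rHist 𝔖.core Z ℓ).ampOp (𝔡 Z ℓ) ρ₀ / Λop
    + (termData 𝔖.F 𝔖.G 𝔖.rHist 𝔖.core Z ℓ).ampHist (𝔡 Z ℓ) ρ₀ / Λhist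
  have := div_nonneg hAop hΛop.le
  have := div_nonneg hAh hΛhist.le
  linarith

/-- [folklore] **ROUTE P2's END ON THE HOLDER's FUNCTIONALS OF RECORD WITH THE WINDOW BINDERS DISCHARGED** (part 1's
`ne5_above_max_record_termModel` + `window_of_majorant` at both runs' input points + `actNorm_le_majorant_of_refAt`).  DISPLAYED (printed
KIND or numeric, over NAMED-PARAMETER cores and constants): L03's letters + the two window numerics `64·log 162 + 64 ≤ R_m`,
`36·A_m·e^{64}·K₀(64,8) < 1`; `WellFormed`; `hsum`; **L06 at BOTH runs' own input points of record** (`RefAt` of every term at `inputB_KP`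
and at `inputA_KP`); the levels; W1∕W4∕W3 of the step of record; numerics.  DISCHARGED: MI-R, L07, L08a∕L08b, L03-geometry, the insertion
structure, R-IDENT's four window binders.  Conclusion `∃ C₅, NE5 (outA 𝔖.toSlots E₀ cB) (outB 𝔖.toSlots E₀ cB) W κ θ′ C₅`.  NOT NE5 proved. -/
theorem ne5_above_max_record_termModel_of_refAt (hT : (assembly 𝔖.toSlots).TransportReads Set.univ) {W : Set (ℕ → ℝ)}
    {m : (ℕ → ℝ) → R.carriers.BgB → R.carriers.Dom → ℝ}
    {A_m R_m τ σ s A₀ E₀' E₁ κ θ δ δ' c ω Λop Λhist ρ₀ ρ₀' : ℝ}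
    -- L03 in letters: the (2.38)-shaped majorant, the two explicit inequalities, and the two window numerics
    (hA_m : 0 ≤ A_m) (hτ : 0 ≤ τ) (hσ : 0 ≤ σ) (hs0 : 0 ≤ s)
    (hm0 : ∀ (g : ℕ → ℝ) (U : R.carriers.BgB) (Z : R.carriers.Dom), 0 ≤ m g U Z)
    (hm : ∀ g ∈ W, ∀ (U : R.carriers.BgB) (k : ℕ), ∀ Z ∈ R.domAt k, m g U Z ≤ A_m * Real.exp (-(R_m * R.carriers.d Z)))
    (hrate : 64 * Real.log 162 + σ + τ * 64 ≤ R_m)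
    (hsmall : (1 + s) * A_m * Real.exp (σ * 5 + τ * 64) * B12TreeDecay.K₀ (4 * 2 ^ 4) (2 * 4) * 9 ≤ τ) (hσκ : κ + 1 ≤ σ)
    (hrate' : 64 * Real.log 162 + 64 ≤ R_m) (hsmall' : 36 * (A_m * Real.exp 64 * B12TreeDecay.K₀ (4 * 2 ^ 4) (2 * 4)) < 1)
    -- L04∕L05: the term family of record is well formed; L03-dom: the per-term majorants sum under `m`
    (hwf : (termFamily 𝔖 E₀ cB 𝔡).WellFormed W)
    (hsum : ∀ g ∈ W, ∀ (U : R.carriers.BgB) (X : R.carriers.Dom), ∀ Z ∈ (domainGeometry R).level (R.carriers.scale X),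
      ∑ ℓ ∈ innerLabels (b13InnerData R) (R.carriers.scale X) Z, (termFamily 𝔖 E₀ cB 𝔡).G Λop Λhist ρ₀ g U X Z ℓ ≤ m g U Z)
    (hρ₁ : ρ₀ ≤ 1)
    -- L06 at BOTH runs' own input points of record
    (hRef : ∀ g ∈ W, ∀ (U : R.carriers.BgB) (X : R.carriers.Dom),
      ∀ Z ∈ (domainGeometry R).level (R.carriers.scale X), ∀ ℓ ∈ innerLabels (b13InnerData R) (R.carriers.scale X) Z,
        (termData 𝔖.F 𝔖.G 𝔖.rHist 𝔖.core Z ℓ).RefAt (𝔡 Z ℓ) (inputB_KP 𝔖.toSlots E₀ cB g U X))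
    (hRefA : ∀ g ∈ W, ∀ (U : R.carriers.BgB) (X : R.carriers.Dom),
      ∀ Z ∈ (domainGeometry R).level (R.carriers.scale X), ∀ ℓ ∈ innerLabels (b13InnerData R) (R.carriers.scale X) Z,
        (termData 𝔖.F 𝔖.G 𝔖.rHist 𝔖.core Z ℓ).RefAt (𝔡 Z ℓ) (inputA_KP 𝔖.toSlots E₀ cB g U X))
    -- levels, W1, W4, W3 in the holder's currency
    (hdA : DecayBound (outA_KP 𝔖.toSlots E₀ cB) W A₀ κ) (hdB : DecayBound (outB_KP 𝔖.toSlots E₀ cB) W E₀' κ)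
    (hop : (step 𝔖.toSlots E₀ cB).OperatorRate W δ θ) (hins : (step 𝔖.toSlots E₀ cB).InsertionRate W κ E₀' δ' θ)
    (hunit : (step 𝔖.toSlots E₀ cB).InsScaleBound W κ E₁ c ω)
    -- numerics
    (hE₁ : 0 < E₁) (hΛop : 0 < Λop) (hΛhist : 0 < Λhist) (hρ : max (Λhist / Λop) 1 * ρ₀' ≤ ρ₀)
    (hs : Λhist * ρ₀' < s) (hδ : 0 ≤ δ) (hδ' : 0 ≤ δ') (hθ : 0 ≤ θ) (hθ1 : θ < 1)
    (hc : 0 ≤ c) (hω : 0 < ω) (hω1 : ω < 1) (hreach : c * (A₀ + E₀') / (1 - ω) < ρ₀')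
    {θ' : ℝ} (hθ' : max θ (ω + (τ * 64 * Real.exp (-(σ * 5))) * Λhist / (s - Λhist * ρ₀') * c) < θ') :
    ∃ C₅, NE5 (outA 𝔖.toSlots E₀ cB) (outB 𝔖.toSlots E₀ cB) W κ θ' C₅ := by
  have hwinA : ∀ g ∈ W, ∀ (U : R.carriers.BgB) (X : R.carriers.Dom),
      LevelSummable 𝔖.toSlots X (inputA_KP 𝔖.toSlots E₀ cB g U X) ∧ ClusAbsConv 𝔖.toSlots X (inputA_KP 𝔖.toSlots E₀ cB g U X) :=
    fun g hg U X => window_of_majorant 𝔖.toSlots hA_m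
      (actNorm_le_majorant_of_refAt 𝔖 E₀ cB 𝔡 hΛop hΛhist hwf hsum hm hg U X (hRefA g hg U X)) hrate' hsmall'
  have hwinB : ∀ g ∈ W, ∀ (U : R.carriers.BgB) (X : R.carriers.Dom),
      LevelSummable 𝔖.toSlots X (inputB_KP 𝔖.toSlots E₀ cB g U X) ∧ ClusAbsConv 𝔖.toSlots X (inputB_KP 𝔖.toSlots E₀ cB g U X) :=
    fun g hg U X => window_of_majorant 𝔖.toSlots hA_m
      (actNorm_le_majorant_of_refAt 𝔖 E₀ cB 𝔡 hΛop hΛhist hwf hsum hm hg U X (hRef g hg U X)) hrate' hsmall'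
  exact ne5_above_max_record_termModel 𝔖 E₀ cB 𝔡 hT (fun g hg U X => (hwinA g hg U X).1) (fun g hg U X => (hwinA g hg U X).2)
    (fun g hg U X => (hwinB g hg U X).1) (fun g hg U X => (hwinB g hg U X).2) hA_m hτ hσ hs0 hm0 hm hrate hsmall hσκ hwf hsum hρ₁
    hRef hdA hdB hop hins hunit hE₁ hΛop hΛhist hρ hs hδ hδ' hθ hθ1 hc hω hω1 hreach hθ'

/-- [folklore] **L09 FOR RUN B ON THE OBJECTS OF RECORD IS A THEOREM** ((2.41) in KP form: K2's `InputModel.decayBound_of_baseMajorant`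
for the term family of record): `DecayBound (outB_KP …) W (64τe^{−5σ}) κ` from L03's letters, `WellFormed`, `hsum` and L06 at run B's point. -/
theorem decayBound_outB_KP_of_refAt (hT : (assembly 𝔖.toSlots).TransportReads Set.univ) {W : Set (ℕ → ℝ)}
    {m : (ℕ → ℝ) → R.carriers.BgB → R.carriers.Dom → ℝ} {A_m R_m τ σ s κ Λop Λhist ρ₀ : ℝ}
    (hA_m : 0 ≤ A_m) (hτ : 0 ≤ τ) (hσ : 0 ≤ σ) (hs0 : 0 ≤ s)
    (hm0 : ∀ (g : ℕ → ℝ) (U : R.carriers.BgB) (Z : R.carriers.Dom), 0 ≤ m g U Z)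
    (hm : ∀ g ∈ W, ∀ (U : R.carriers.BgB) (k : ℕ), ∀ Z ∈ R.domAt k, m g U Z ≤ A_m * Real.exp (-(R_m * R.carriers.d Z)))
    (hrate : 64 * Real.log 162 + σ + τ * 64 ≤ R_m)
    (hsmall : (1 + s) * A_m * Real.exp (σ * 5 + τ * 64) * B12TreeDecay.K₀ (4 * 2 ^ 4) (2 * 4) * 9 ≤ τ) (hσκ : κ + 1 ≤ σ)
    (hwf : (termFamily 𝔖 E₀ cB 𝔡).WellFormed W) (hΛop : 0 < Λop) (hΛhist : 0 < Λhist)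
    (hsum : ∀ g ∈ W, ∀ (U : R.carriers.BgB) (X : R.carriers.Dom), ∀ Z ∈ (domainGeometry R).level (R.carriers.scale X),
      ∑ ℓ ∈ innerLabels (b13InnerData R) (R.carriers.scale X) Z, (termFamily 𝔖 E₀ cB 𝔡).G Λop Λhist ρ₀ g U X Z ℓ ≤ m g U Z)
    (hRef : ∀ g ∈ W, ∀ (U : R.carriers.BgB) (X : R.carriers.Dom),
      ∀ Z ∈ (domainGeometry R).level (R.carriers.scale X), ∀ ℓ ∈ innerLabels (b13InnerData R) (R.carriers.scale X) Z,
        (termData 𝔖.F 𝔖.G 𝔖.rHist 𝔖.core Z ℓ).RefAt (𝔡 Z ℓ) (inputB_KP 𝔖.toSlots E₀ cB g U X)) :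
    DecayBound (outB_KP 𝔖.toSlots E₀ cB) W (τ * 64 * Real.exp (-(σ * 5))) κ :=
  (termFamily 𝔖 E₀ cB 𝔡).model.decayBound_of_baseMajorant (represents_kp 𝔖.toSlots E₀ cB hT) (realizes_termFamily 𝔖 E₀ cB 𝔡 W)
    (inBase_termFamily 𝔖 E₀ cB 𝔡 hRef) ((termFamily 𝔖 E₀ cB 𝔡).baseMajorant_model hwf hΛop hΛhist hsum)
    (kpInflated_b13 (rhoA 𝔖.toSlots E₀ cB) (rhoB 𝔖.toSlots E₀ cB) hA_m hτ hσ hs0 hm0 hm hrate hsmall) hs0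
    (decayExtract_b13 (rhoA 𝔖.toSlots E₀ cB) (rhoB 𝔖.toSlots E₀ cB) hσ)
    (pinBudget_b13 (rhoA 𝔖.toSlots E₀ cB) (rhoB 𝔖.toSlots E₀ cB) hτ hσκ)

/-- [folklore] **L09 FOR RUN A ON THE OBJECTS OF RECORD IS A THEOREM** (§1b with the reference data at run A's own input point). -/
theorem decayBound_outA_KP_of_refAt (hT : (assembly 𝔖.toSlots).TransportReads Set.univ) {W : Set (ℕ → ℝ)}
    {m : (ℕ → ℝ) → R.carriers.BgB → R.carriers.Dom → ℝ} {A_m R_m τ σ s κ Λop Λhist ρ₀ : ℝ}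
    (hA_m : 0 ≤ A_m) (hτ : 0 ≤ τ) (hσ : 0 ≤ σ) (hs0 : 0 ≤ s)
    (hm0 : ∀ (g : ℕ → ℝ) (U : R.carriers.BgB) (Z : R.carriers.Dom), 0 ≤ m g U Z)
    (hm : ∀ g ∈ W, ∀ (U : R.carriers.BgB) (k : ℕ), ∀ Z ∈ R.domAt k, m g U Z ≤ A_m * Real.exp (-(R_m * R.carriers.d Z)))
    (hrate : 64 * Real.log 162 + σ + τ * 64 ≤ R_m)
    (hsmall : (1 + s) * A_m * Real.exp (σ * 5 + τ * 64) * B12TreeDecay.K₀ (4 * 2 ^ 4) (2 * 4) * 9 ≤ τ) (hσκ : κ + 1 ≤ σ)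
    (hwf : (termFamily 𝔖 E₀ cB 𝔡).WellFormed W) (hΛop : 0 < Λop) (hΛhist : 0 < Λhist)
    (hsum : ∀ g ∈ W, ∀ (U : R.carriers.BgB) (X : R.carriers.Dom), ∀ Z ∈ (domainGeometry R).level (R.carriers.scale X),
      ∑ ℓ ∈ innerLabels (b13InnerData R) (R.carriers.scale X) Z, (termFamily 𝔖 E₀ cB 𝔡).G Λop Λhist ρ₀ g U X Z ℓ ≤ m g U Z)
    (hRefA : ∀ g ∈ W, ∀ (U : R.carriers.BgB) (X : R.carriers.Dom),
      ∀ Z ∈ (domainGeometry R).level (R.carriers.scale X), ∀ ℓ ∈ innerLabels (b13InnerData R) (R.carriers.scale X) Z,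
        (termData 𝔖.F 𝔖.G 𝔖.rHist 𝔖.core Z ℓ).RefAt (𝔡 Z ℓ) (inputA_KP 𝔖.toSlots E₀ cB g U X)) :
    DecayBound (outA_KP 𝔖.toSlots E₀ cB) W (τ * 64 * Real.exp (-(σ * 5))) κ :=
  decayBoundA_of_baseMajorant (termFamily 𝔖 E₀ cB 𝔡).model (represents_kp 𝔖.toSlots E₀ cB hT) (realizes_termFamily 𝔖 E₀ cB 𝔡 W)
    (fun g hg U X => hRefA g hg U X) ((termFamily 𝔖 E₀ cB 𝔡).baseMajorant_model hwf hΛop hΛhist hsum)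
    (kpInflated_b13 (rhoA 𝔖.toSlots E₀ cB) (rhoB 𝔖.toSlots E₀ cB) hA_m hτ hσ hs0 hm0 hm hrate hsmall) hs0
    (decayExtract_b13 (rhoA 𝔖.toSlots E₀ cB) (rhoB 𝔖.toSlots E₀ cB) hσ)
    (pinBudget_b13 (rhoA 𝔖.toSlots E₀ cB) (rhoB 𝔖.toSlots E₀ cB) hτ hσκ) (by positivity)
    fun g _ V hV X => outA_KP_of_not_transport 𝔖.toSlots E₀ cB hV X

/-- [folklore] **ROUTE P2's END ON THE HOLDER's FUNCTIONALS OF RECORD — WINDOW BINDERS AND BOTH LEVELS DISCHARGED** (the most reduced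
face of the activity route on Bałaban's carriers for term-format slots).  DISPLAYED: L03's letters + the two window numerics; `WellFormed`;
`hsum`; L06 at BOTH runs' own input points; W1 `OperatorRate`, W4 `InsertionRate` (at the derived level `64τe^{−5σ}`), W3 `InsScaleBound`;
numerics (the history reach reads `c·(2·64τe^{−5σ})∕(1 − ω) < ρ₀′`).  DISCHARGED: MI-R, L07, L08a∕b, L03-geometry, **L09 (both levels)**, the
insertion structure, the window binders.  Conclusion `∃ C₅, NE5 (outA 𝔖.toSlots E₀ cB) (outB 𝔖.toSlots E₀ cB) W κ θ′ C₅`.  NOT NE5 proved. -/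
theorem ne5_above_max_record_termModel_levels (hT : (assembly 𝔖.toSlots).TransportReads Set.univ) {W : Set (ℕ → ℝ)}
    {m : (ℕ → ℝ) → R.carriers.BgB → R.carriers.Dom → ℝ}
    {A_m R_m τ σ s E₁ κ θ δ δ' c ω Λop Λhist ρ₀ ρ₀' : ℝ}
    -- L03 in letters + the two window numerics
    (hA_m : 0 ≤ A_m) (hτ : 0 ≤ τ) (hσ : 0 ≤ σ) (hs0 : 0 ≤ s)
    (hm0 : ∀ (g : ℕ → ℝ) (U : R.carriers.BgB) (Z : R.carriers.Dom), 0 ≤ m g U Z)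
    (hm : ∀ g ∈ W, ∀ (U : R.carriers.BgB) (k : ℕ), ∀ Z ∈ R.domAt k, m g U Z ≤ A_m * Real.exp (-(R_m * R.carriers.d Z)))
    (hrate : 64 * Real.log 162 + σ + τ * 64 ≤ R_m)
    (hsmall : (1 + s) * A_m * Real.exp (σ * 5 + τ * 64) * B12TreeDecay.K₀ (4 * 2 ^ 4) (2 * 4) * 9 ≤ τ) (hσκ : κ + 1 ≤ σ)
    (hrate' : 64 * Real.log 162 + 64 ≤ R_m) (hsmall' : 36 * (A_m * Real.exp 64 * B12TreeDecay.K₀ (4 * 2 ^ 4) (2 * 4)) < 1)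
    -- L04∕L05, L03-dom
    (hwf : (termFamily 𝔖 E₀ cB 𝔡).WellFormed W)
    (hsum : ∀ g ∈ W, ∀ (U : R.carriers.BgB) (X : R.carriers.Dom), ∀ Z ∈ (domainGeometry R).level (R.carriers.scale X),
      ∑ ℓ ∈ innerLabels (b13InnerData R) (R.carriers.scale X) Z, (termFamily 𝔖 E₀ cB 𝔡).G Λop Λhist ρ₀ g U X Z ℓ ≤ m g U Z)
    (hρ₁ : ρ₀ ≤ 1)
    -- L06 at BOTH runs' own input points of record
    (hRef : ∀ g ∈ W, ∀ (U : R.carriers.BgB) (X : R.carriers.Dom),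
      ∀ Z ∈ (domainGeometry R).level (R.carriers.scale X), ∀ ℓ ∈ innerLabels (b13InnerData R) (R.carriers.scale X) Z,
        (termData 𝔖.F 𝔖.G 𝔖.rHist 𝔖.core Z ℓ).RefAt (𝔡 Z ℓ) (inputB_KP 𝔖.toSlots E₀ cB g U X))
    (hRefA : ∀ g ∈ W, ∀ (U : R.carriers.BgB) (X : R.carriers.Dom),
      ∀ Z ∈ (domainGeometry R).level (R.carriers.scale X), ∀ ℓ ∈ innerLabels (b13InnerData R) (R.carriers.scale X) Z,
        (termData 𝔖.F 𝔖.G 𝔖.rHist 𝔖.core Z ℓ).RefAt (𝔡 Z ℓ) (inputA_KP 𝔖.toSlots E₀ cB g U X))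
    -- W1, W4, W3 in the holder's currency
    (hop : (step 𝔖.toSlots E₀ cB).OperatorRate W δ θ)
    (hins : (step 𝔖.toSlots E₀ cB).InsertionRate W κ (τ * 64 * Real.exp (-(σ * 5))) δ' θ)
    (hunit : (step 𝔖.toSlots E₀ cB).InsScaleBound W κ E₁ c ω)
    -- numerics
    (hE₁ : 0 < E₁) (hΛop : 0 < Λop) (hΛhist : 0 < Λhist) (hρ : max (Λhist / Λop) 1 * ρ₀' ≤ ρ₀)
    (hs : Λhist * ρ₀' < s) (hδ : 0 ≤ δ) (hδ' : 0 ≤ δ') (hθ : 0 ≤ θ) (hθ1 : θ < 1)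
    (hc : 0 ≤ c) (hω : 0 < ω) (hω1 : ω < 1)
    (hreach : c * (τ * 64 * Real.exp (-(σ * 5)) + τ * 64 * Real.exp (-(σ * 5))) / (1 - ω) < ρ₀')
    {θ' : ℝ} (hθ' : max θ (ω + (τ * 64 * Real.exp (-(σ * 5))) * Λhist / (s - Λhist * ρ₀') * c) < θ') :
    ∃ C₅, NE5 (outA 𝔖.toSlots E₀ cB) (outB 𝔖.toSlots E₀ cB) W κ θ' C₅ :=
  ne5_above_max_record_termModel_of_refAt 𝔖 E₀ cB 𝔡 hT hA_m hτ hσ hs0 hm0 hm hrate hsmall hσκ hrate' hsmall' hwf hsum hρ₁ hRef hRefA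
    (decayBound_outA_KP_of_refAt 𝔖 E₀ cB 𝔡 hT hA_m hτ hσ hs0 hm0 hm hrate hsmall hσκ hwf hΛop hΛhist hsum hRefA)
    (decayBound_outB_KP_of_refAt 𝔖 E₀ cB 𝔡 hT hA_m hτ hσ hs0 hm0 hm hrate hsmall hσκ hwf hΛop hΛhist hsum hRef)
    hop hins hunit hE₁ hΛop hΛhist hρ hs hδ hδ' hθ hθ1 hc hω hω1 hreach hθ'

end TermFormat

end Summit.QuantumFields.BalabanUV.T4Continuum.B13KPStepTermWindow

end
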